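import Literature.Geometry.Riemannian.GaussBonnetGradient
import Literature.Geometry.Manifold.CompleteFlow
import Literature.Geometry.Riemannian.ShrinkerScalarCurvatureNonnegHolds
import Literature.Geometry.Riemannian.ShrinkerPotentialProper
import HarnessLib

/-!
# Helper `helper_shrinkerGradientFlow` of line `collapsed-ends-usc` (crux
# `EntropyRung.NoncompactShrinkerGap`, stmt-SmoothPoincare4-10868): the gradient field of the
# potential of a complete gradient shrinker is complete

Registered helper stub (lead c15, wave 2, brick 3a of the printed chain of route item 16588,
`shrinkerSplittingAtInfinity_four`): for a complete connected normalised gradient shrinking Ricci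
soliton `(Mⁿ, g, f)`, `Ric + Hess f = g/2`, `R + |∇f|² = f`, closed `g.edist`-balls compact, the
gradient field `∇f = grad_g f` is **complete**: it generates a smooth global flow
`θ : ℝ × M → M` (`θ(0, p) = p`, group law, orbits = integral curves of `grad_g f`), along which
`f` is non-decreasing and grows at most exponentially, `f(θ(t, p)) ≤ eᵗ f(p)` for `t ≥ 0`
(Naber 2010, Lemma 1.1: the soliton's canonical Ricci flow `g(t) = (1 − t) ψ_t^* g` with
`∂ₜ ψₜ = ∇f / (1 − t)`, `ψ_t = θ(−log(1 − t), ·)`, starts from this completeness).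

Proof. Along an integral curve `γ` of `grad f`, `u = f ∘ γ` has
`u' = df(grad f) = g⁻¹(df, df) = |∇f|² = f − R ∈ [0, u]`, because `R ≥ 0`
(`shrinkerScalarCurvature_nonneg_holds`, Zhang 2009) and `|∇f|²_g ≥ 0`; so `u` is monotone and
`(e^{−t} u)' ≤ 0`, whence `u(t) ≤ e^{|T|} u(0)` for `|t| ≤ T`: the curve is confined to the
sub-level set `{f ≤ e^{|T|} f(γ 0)}`, which is compact because the potential is proper
(`Shrinker.isCompact_potential_le`, Haslhofer–Müller 2011, Lemma 2.1). A priori compact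
confinement gives completeness (`exists_isMIntegralCurve_of_apriori_isCompact`, Lee 2013,
Lemma 9.19) and a complete smooth field generates a smooth global flow
(`exists_contMDiff_globalFlow_of_complete`, Lee 2013, Thm. 9.12). The generic statement
(`exists_globalFlow_grad_of_gradSq_le`: any Riemannian `g`, `f` smooth with compact sub-level
sets and `|∇f|² ≤ f`) is separated from the shrinker bookkeeping. Everything is proved; no
definitions, no named facts.

## References

* [Naber2010] A. Naber, *Noncompact shrinking four solitons with nonnegative curvature*,
  J. reine angew. Math. 645 (2010), Lemma 1.1.
* [LeeSmoothManifolds2013] J. M. Lee, *Introduction to Smooth Manifolds*, 2nd ed., Thm. 9.12,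
  Lemma 9.19.
* [HaslhoferMuller2011] R. Haslhofer, R. Müller, GAFA 21 (2011), Lemma 2.1.
* [Zhang2009] Z.-H. Zhang, Proc. AMS 137 (2009), Thm. 1.3 (ii).
-/

noncomputable section

-- `Summit.SmoothPoincare4.SmoothPoincare4.…` (summit = problem) trips `dupNamespace` on every decl.
set_option linter.dupNamespace false

open scoped Manifold ContDiff ENNReal NNReal Topology
open MeasureTheory Set Filter Module
open Literature.Geometry.Lorentzian Literature.Geometry.Riemannian

namespace Summit.SmoothPoincare4.SmoothPoincare4.Theorems.NoncompactShrinkerGapNoncollapsing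

/-! ### Two real-variable lemmas: `0 ≤ u' ≤ u` on an interval -/

/-- If `u` is differentiable on an order-connected set `J` with `u' ≥ 0` there, then `u` is
monotone on `J`. [folklore] -/
theorem monotoneOn_of_hasDerivAt_nonneg {J : Set ℝ} (hJ : J.OrdConnected) {u u' : ℝ → ℝ}
    (hu : ∀ s ∈ J, HasDerivAt u (u' s) s) (hu' : ∀ s ∈ J, 0 ≤ u' s) : MonotoneOn u J :=
  monotoneOn_of_hasDerivWithinAt_nonneg hJ.convex
    (fun s hs ↦ (hu s hs).continuousAt.continuousWithinAt)
    (fun s hs ↦ (hu s (interior_subset hs)).hasDerivWithinAt)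
    fun s hs ↦ hu' s (interior_subset hs)

/-- **Grönwall, the case `u' ≤ u`**: if `u` is differentiable on an order-connected set `J ∋ 0`
with `u' ≤ u` there, then `u t ≤ eᵗ u 0` for `t ∈ J`, `t ≥ 0` (`e^{-t} u` is non-increasing).
[folklore] -/
theorem le_exp_mul_of_hasDerivAt_le {J : Set ℝ} (hJ : J.OrdConnected) {u u' : ℝ → ℝ}
    (hu : ∀ s ∈ J, HasDerivAt u (u' s) s) (hu' : ∀ s ∈ J, u' s ≤ u s) (h0 : (0 : ℝ) ∈ J)
    {t : ℝ} (ht : t ∈ J) (ht0 : 0 ≤ t) : u t ≤ Real.exp t * u 0 := by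
  have hv : ∀ s ∈ J, HasDerivAt (fun s ↦ Real.exp (-s) * u s)
      (Real.exp (-s) * (-1) * u s + Real.exp (-s) * u' s) s := fun s hs ↦
    ((hasDerivAt_neg s).exp).mul (hu s hs)
  have hanti : AntitoneOn (fun s ↦ Real.exp (-s) * u s) J := by
    refine antitoneOn_of_hasDerivWithinAt_nonpos hJ.convex
      (fun s hs ↦ (hv s hs).continuousAt.continuousWithinAt)
      (fun s hs ↦ (hv s (interior_subset hs)).hasDerivWithinAt) fun s hs ↦ ?_
    have h1 := hu' s (interior_subset hs)
    have h2 := Real.exp_pos (-s)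
    nlinarith
  have h := hanti h0 ht ht0
  simp only [neg_zero, Real.exp_zero, one_mul] at h
  have hexp : Real.exp t * Real.exp (-t) = 1 := by
    rw [← Real.exp_add, add_neg_cancel, Real.exp_zero]
  calc u t = Real.exp t * (Real.exp (-t) * u t) := by rw [← mul_assoc, hexp, one_mul]
    _ ≤ Real.exp t * u 0 := mul_le_mul_of_nonneg_left h (Real.exp_pos t).le

/-! ### The derivative of a function along an integral curve -/

section AlongCurve

variable {E : Type*} [NormedAddCommGroup E] [NormedSpace ℝ E] {H : Type*} [TopologicalSpace H]
  {I : ModelWithCorners ℝ E H} {M : Type*} [TopologicalSpace M] [ChartedSpace H M]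

/-- Along an integral curve `γ` of a vector field `V` on an open set of parameters `J`, a
differentiable function `f` has derivative `(f ∘ γ)'(s) = df_{γ s}(V (γ s))`. [folklore] -/
theorem hasDerivAt_comp_of_isMIntegralCurveOn {f : M → ℝ} {V : Π x : M, TangentSpace I x}
    {γ : ℝ → M} {J : Set ℝ} (hJ : IsOpen J) (hγ : IsMIntegralCurveOn γ V J) {s : ℝ} (hs : s ∈ J)
    (hf : MDifferentiableAt I 𝓘(ℝ, ℝ) f (γ s)) :
    HasDerivAt (f ∘ γ) (mfderiv I 𝓘(ℝ, ℝ) f (γ s) (V (γ s))) s := by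
  -- adapted from `LorentzianMetric.hasDerivAt_comp_of_hasMFDerivAt` (`NoncompactCauchyFutureSet`)
  have hγs : HasMFDerivAt 𝓘(ℝ, ℝ) I γ s ((1 : ℝ →L[ℝ] ℝ).smulRight (V (γ s))) :=
    (hγ s hs).hasMFDerivAt (hJ.mem_nhds hs)
  have h0 := (hf.hasMFDerivAt.comp s hγs).hasFDerivAt
  have hL : (mfderiv I 𝓘(ℝ, ℝ) f (γ s)).comp ((1 : ℝ →L[ℝ] ℝ).smulRight (V (γ s))) =
      (1 : ℝ →L[ℝ] ℝ).smulRight (mfderiv I 𝓘(ℝ, ℝ) f (γ s) (V (γ s))) := by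
    ext
    simp
  exact hasDerivAt_iff_hasFDerivAt.mpr (h0.congr_fderiv hL)

end AlongCurve

/-! ### Completeness of a gradient field with `|∇f|² ≤ f` and `f` proper -/

section Generic

variable {E : Type*} [NormedAddCommGroup E] [NormedSpace ℝ E] [FiniteDimensional ℝ E]
  {M : Type*} [TopologicalSpace M] [ChartedSpace E M] [IsManifold 𝓘(ℝ, E) ∞ M]
  (g : PseudoRiemannianMetric 𝓘(ℝ, E) ∞ E (TangentSpace 𝓘(ℝ, E) : M → Type _))

/-- `df(grad_g f) = g⁻¹(df, df) = |∇f|²_g`. [folklore] -/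
theorem mfderiv_grad_eq_gradSq (f : M → ℝ) (y : M) :
    mfderiv 𝓘(ℝ, E) 𝓘(ℝ, ℝ) f y (grad g f y) = g.gradSq f y := rfl

/-- `|∇f|²_g ≥ 0` for a Riemannian metric (`g⁻¹(α, α) = g(♯α, ♯α) ≥ 0`). [folklore] -/
theorem gradSq_nonneg_of_isRiemannian (hg : g.IsRiemannian) (f : M → ℝ) (x : M) :
    0 ≤ g.gradSq f x := by
  rw [PseudoRiemannianMetric.gradSq, PseudoRiemannianMetric.innerDual_eq_val_sharp_sharp]
  by_cases h : g.sharp x (mvfderiv 𝓘(ℝ, E) f x : TangentSpace 𝓘(ℝ, E) x →ₗ[ℝ] ℝ) = 0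
  · rw [h]; simp
  · exact (hg x _ h).le

/-- Along an integral curve `γ` (on an open set of parameters `J`) of the gradient field of a
smooth `f`, `(f ∘ γ)' = |∇f|²_g ∘ γ`. [folklore] -/
theorem hasDerivAt_comp_of_isMIntegralCurveOn_grad {f : M → ℝ}
    (hf : ContMDiff 𝓘(ℝ, E) 𝓘(ℝ, ℝ) ∞ f) {γ : ℝ → M} {J : Set ℝ} (hJ : IsOpen J)
    (hγ : IsMIntegralCurveOn γ (grad g f) J) {s : ℝ} (hs : s ∈ J) :
    HasDerivAt (f ∘ γ) (g.gradSq f (γ s)) s := by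
  rw [← mfderiv_grad_eq_gradSq]
  exact hasDerivAt_comp_of_isMIntegralCurveOn hJ hγ hs ((hf (γ s)).mdifferentiableAt (by simp))

/-- **A gradient field with `|∇f|² ≤ f` and proper `f` is complete, with monotone and at most
exponentially growing `f` along its flow.** On a Hausdorff manifold modelled on a
finite-dimensional real normed space, let `g` be a smooth Riemannian metric and `f` a smooth
function with compact sub-level sets `{f ≤ c}` and `|∇f|²_g ≤ f`. Then `grad_g f` generates a
smooth global flow `θ : ℝ × M → M` — `θ(0, p) = p`, `θ(t, θ(s, p)) = θ(t + s, p)`, the orbits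
`t ↦ θ(t, p)` are integral curves of `grad_g f` — and along it `f` is non-decreasing with
`f(θ(t, p)) ≤ eᵗ f(p)` for `t ≥ 0`. Proof: `(f ∘ γ)' = |∇f|² ∈ [0, f ∘ γ]` along integral curves,
so they are confined to the compact `{f ≤ e^{|T|} f(γ 0)}` for `|t| ≤ T`; escape lemma
(`exists_isMIntegralCurve_of_apriori_isCompact`) and the fundamental theorem on flows of complete
fields (`exists_contMDiff_globalFlow_of_complete`).
[cite: LeeSmoothManifolds2013, Lemma 9.19 and Thm. 9.12] -/
theorem exists_globalFlow_grad_of_gradSq_le [T2Space M] (hg : g.IsRiemannian) {f : M → ℝ}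
    (hf : ContMDiff 𝓘(ℝ, E) 𝓘(ℝ, ℝ) ∞ f) (hK : ∀ c : ℝ, IsCompact {y : M | f y ≤ c})
    (hle : ∀ x, g.gradSq f x ≤ f x) :
    ∃ θ : ℝ × M → M, ContMDiff (𝓘(ℝ, ℝ).prod 𝓘(ℝ, E)) 𝓘(ℝ, E) ∞ θ ∧ (∀ p, θ (0, p) = p) ∧
      (∀ t s p, θ (t, θ (s, p)) = θ (t + s, p)) ∧
      (∀ p, IsMIntegralCurve (fun t ↦ θ (t, p)) (grad g f)) ∧
      (∀ p s t, s ≤ t → f (θ (s, p)) ≤ f (θ (t, p))) ∧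
      ∀ p t, 0 ≤ t → f (θ (t, p)) ≤ Real.exp t * f p := by
  haveI : CompleteSpace E := FiniteDimensional.complete ℝ E
  have hV : ContMDiff 𝓘(ℝ, E) 𝓘(ℝ, E).tangent ∞
      fun x ↦ (⟨x, grad g f x⟩ : TangentBundle 𝓘(ℝ, E) M) := contMDiff_grad g hf
  have hf0 : ∀ x, 0 ≤ f x := fun x ↦ (gradSq_nonneg_of_isRiemannian g hg f x).trans (hle x)
  -- `f` is monotone along integral curves on open order-connected parameter sets
  have hmono : ∀ (γ : ℝ → M) (J : Set ℝ), IsOpen J → J.OrdConnected →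
      IsMIntegralCurveOn γ (grad g f) J → MonotoneOn (f ∘ γ) J := fun γ J hJo hJc hγ ↦
    monotoneOn_of_hasDerivAt_nonneg hJc
      (fun s hs ↦ hasDerivAt_comp_of_isMIntegralCurveOn_grad g hf hJo hγ hs)
      fun s _ ↦ gradSq_nonneg_of_isRiemannian g hg f _
  -- and grows at most exponentially
  have hgrow : ∀ (γ : ℝ → M) (J : Set ℝ), IsOpen J → J.OrdConnected → (0 : ℝ) ∈ J →
      IsMIntegralCurveOn γ (grad g f) J → ∀ t ∈ J, 0 ≤ t →
        f (γ t) ≤ Real.exp t * f (γ 0) := fun γ J hJo hJc h0J hγ t htJ ht0 ↦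
    le_exp_mul_of_hasDerivAt_le (u := f ∘ γ) hJc
      (fun s hs ↦ hasDerivAt_comp_of_isMIntegralCurveOn_grad g hf hJo hγ hs)
      (fun s _ ↦ hle _) h0J htJ ht0
  -- completeness from the a priori confinement to `{f ≤ e^{|T|} f x}`
  have hc : ∀ x : M, ∃ γ : ℝ → M, γ 0 = x ∧ IsMIntegralCurve γ (grad g f) := by
    refine Literature.Geometry.Manifold.exists_isMIntegralCurve_of_apriori_isCompact
      (n := (⊤ : ℕ∞)) hV le_top fun x T ↦ ?_
    refine ⟨{y | f y ≤ Real.exp |T| * f x}, hK _, fun γ J hJo hJc h0J hγ0 hγ t htJ htT ↦ ?_⟩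
    show f (γ t) ≤ Real.exp |T| * f x
    rcases le_total 0 t with ht0 | ht0
    · calc f (γ t) ≤ Real.exp t * f (γ 0) := hgrow γ J hJo hJc h0J hγ t htJ ht0
        _ ≤ Real.exp |T| * f x := by
          rw [hγ0]
          have h1 : t ≤ |T| := ((le_abs_self t).trans htT).trans (le_abs_self T)
          exact mul_le_mul_of_nonneg_right (Real.exp_le_exp.2 h1) (hf0 x)
    · calc f (γ t) ≤ f (γ 0) := hmono γ J hJo hJc hγ htJ h0J ht0
        _ ≤ Real.exp |T| * f x := by
          rw [hγ0]
          have h1 : (1 : ℝ) ≤ Real.exp |T| := Real.one_le_exp (abs_nonneg T)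
          nlinarith [hf0 x]
  obtain ⟨θ, hθs, hθ0, hθadd, hθint⟩ :=
    Literature.Geometry.Manifold.exists_contMDiff_globalFlow_of_complete (n := (⊤ : ℕ∞)) hV
      le_top hc
  refine ⟨θ, hθs, hθ0, hθadd, hθint, fun p s t hst ↦ ?_, fun p t ht ↦ ?_⟩
  · exact hmono (fun t ↦ θ (t, p)) univ isOpen_univ ordConnected_univ
      ((hθint p).isMIntegralCurveOn _) (mem_univ s) (mem_univ t) hst
  · have h := hgrow (fun t ↦ θ (t, p)) univ isOpen_univ ordConnected_univ (mem_univ _)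
      ((hθint p).isMIntegralCurveOn _) t (mem_univ t) ht
    rwa [hθ0] at h

end Generic

/-! ### The registered stub -/

/-- Registered helper `helper_shrinkerGradientFlow` (lead c15, wave 2): **the gradient field of
the potential of a complete normalised gradient shrinker is complete.** For a complete (closed
`g.edist`-balls compact) connected gradient shrinking Ricci soliton `Ric + Hess f = g/2` with
smooth potential normalised by `R + |∇f|² = f`, the field `grad_g f` generates a smooth global
flow `θ : ℝ × M → M` (`θ(0, p) = p`, group law `θ(t, θ(s, p)) = θ(t + s, p)`, orbits = integral
curves of `grad_g f`), `f` is non-decreasing along the orbits, and `f(θ(t, p)) ≤ eᵗ f(p)` for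
`t ≥ 0`. Proof: `R ≥ 0` (`shrinkerScalarCurvature_nonneg_holds`) gives `|∇f|² = f − R ≤ f`, the
potential is proper (`Shrinker.isCompact_potential_le`), and
`exists_globalFlow_grad_of_gradSq_le` applies.
[cite: Naber2010, Lemma 1.1] [cite: LeeSmoothManifolds2013, Lemma 9.19 and Thm. 9.12] -/
theorem helper_shrinkerGradientFlow : ∀ (n : ℕ) (M : Type) [TopologicalSpace M] [T2Space M] [SecondCountableTopology M] [ChartedSpace (EuclideanSpace ℝ (Fin n)) M] [IsManifold (𝓡 n) ∞ M] [ConnectedSpace M] [T3Space M] [MeasurableSpace M] [BorelSpace M] (g : PseudoRiemannianMetric (𝓡 n) ∞ (EuclideanSpace ℝ (Fin n)) (TangentSpace (𝓡 n) : M → Type _)) [g.HasLeviCivita] (f : M → ℝ) (hg : g.IsRiemannian), (∀ (x : M) (r : NNReal), IsCompact {y : M | g.edist hg x y ≤ r}) → ContMDiff (𝓡 n) 𝓘(ℝ, ℝ) ∞ f → (∀ (x : M) (X Y : TangentSpace (𝓡 n) x), g.ricci x X Y + g.hessian f x X Y = (1 / 2 : ℝ) * g.val x X Y) → (∀ x :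 M, g.scalarCurvature x + g.gradSq f x = f x) → ∃ θ : ℝ × M → M, ContMDiff (𝓘(ℝ, ℝ).prod (𝓡 n)) (𝓡 n) ∞ θ ∧ (∀ p, θ (0, p) = p) ∧ (∀ t s p, θ (t, θ (s, p)) = θ (t + s, p)) ∧ (∀ p, IsMIntegralCurve (fun t ↦ θ (t, p)) (Literature.Geometry.Riemannian.grad g f)) ∧ (∀ p s t, s ≤ t → f (θ (s, p)) ≤ f (θ (t, p))) ∧ ∀ p t, 0 ≤ t → f (θ (t, p)) ≤ Real.exp t * f p := by
  intro n M _ _ _ _ _ _ _ _ _ g _ f hg hc hf hsol hnorm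
  have hR : ∀ x : M, 0 ≤ g.scalarCurvature x :=
    shrinkerScalarCurvature_nonneg_holds n M g f hg hc hf hsol hnorm
  have hK : ∀ c : ℝ, IsCompact {y : M | f y ≤ c} :=
    Shrinker.isCompact_potential_le g hg hc hf hsol hnorm hR
  have hle : ∀ x, g.gradSq f x ≤ f x := fun x ↦ by linarith [hR x, hnorm x]
  exact exists_globalFlow_grad_of_gradSq_le g hg hf hK hle

end Summit.SmoothPoincare4.SmoothPoincare4.Theorems.NoncompactShrinkerGapNoncollapsing

end
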